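import Summits.BirchSwinnertonDyer.BirchSwinnertonDyer.Theorems.PrintX10bHowardAssembly
import Literature.NumberTheory.EllipticCurves.NonvanishingTwistsProofs
import Literature.NumberTheory.EllipticCurves.MordellWeil
import Literature.NumberTheory.LFunctions.ChebotarevDensityNumberField
import HarnessLib

/-!
# Line «ono-waldspurger-supply» (bsd-idea-5 g9, lens TRANSFER) on crux
# `PrintX10b.HowardContainmentAnyClassNumberX10b` (stmt-BirchSwinnertonDyer-23729; row 10, rung W-ALL/10)

BSD is not proved by any of this. PUBLISH-ONLY skeleton (W-79): nothing booked, no route edited, no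
`skeleton check` (a line of record is seated on the item).

WHERE IT SITS. g8's line «coprime-frame-supply» (same directory, rev 3) transferred the crux to
C⁺ = `SupplyCoprimeFrameX10b` (restated below VERBATIM; it is the hypothesis `hFS3` of the tree kernel
`X10.howardAssemblyThree_of_howardFrameSupply`): every non-CM rank-one X10b curve has a light Heegner
frame `K` with `3 ∤ h_K` AND `L(E^{(d_K)},1) ≠ 0`. Its open residual D2 is a NON-VANISHING DENSITY
(> 1/2 of the light class: weak Goldfeld on a thin family — no adjacent theorem in print).

TRANSFER (the g9 lever). Ono 2001 (J. reine angew. Math. 533, Thm. 1 / Cor. 3; mechanism: Kohnen–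
Waldspurger weight-3/2 form `g_E`, `G_E = g_E·θ`, Deligne–Serre Galois representations mod `2^{s₀+1}`)
gives, for every `E/ℚ` WITHOUT a rational point of order 2 (`⟺ a_p(E)` odd for some `p`; here:
`Odd #E(ℚ)_tors`) and root number `−1`, a fundamental `D_E < 0` and a set of primes `S_E` of POSITIVE
DENSITY (a Chebotarev class) with `L(E^{(D_E p₁⋯p_{2j})},1) ≠ 0` for ALL even sets of distinct
`pᵢ ∈ S_E`. So on the odd-torsion sub-class the `L`-condition of C⁺ is FREE on a multiplicatively
structured family, and the residual becomes L-FREE and E-FREE: `stub_pairClassNumberCoprimeFrob` — «in a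
positive-density set of primes all of whose pair-products `D·p₁p₂` lie in the light class, some
pair-product has class number prime to 3» — arithmetic statistics of 3-class groups along P₂-type
discriminants with CHEBOTAREV-CONTROLLED prime factors, adjacent to Belabas–Fouvry 1999 (Duke 98,
Cor. 1.9 (II): `r₃(Δ) = 0` for `≫ X/log X` negative `Δ` with ≤ 4 prime factors — factors NOT
Frobenius-controlled) and to Horie–Nakagawa / Bhargava–Varma (finitely many local conditions).
Kriz–Li 2019 (FMS 7, Thm. 4.3: mod-2 Heegner congruence, family of all products of primes split in an
auxiliary `K₀` with `a_ℓ` odd) is the variant print input (needs their unit condition (★)); not a stub.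

SKELETON (REV 3 — 4 stubs + two PROVED homogenisation lemmas + kernel-checked compositions; sorries ONLY
inside `stub_*`; REV 3 = critic V#127 prices P1 (S3 frobenian) + P2 (S2 PRINT-COMPOSITE chain)):
* `stub_onoEvenProductFamily` — PRINT BY NAME (Ono 2001 Thm. 1 + Cor. 3, output shape; Chebotarev
  density): odd torsion order ∧ analytic rank 1 ⟹ an Ono datum `(D, S)`.
* `stub_onoLightBase` — PRINT-COMPOSITE (REV 3; per-curve certificate the cheap route): some Ono datum of
  a rank-one non-CM X10b curve with odd torsion has a LIGHT BASE `D_E` (odd squarefree, `≡ 1 (4)`/`(8)`,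
  every odd `q ∣ 3N_E` split) ⟸ Waldspurger-packet member seeing the light square class (root number
  `+1` ✓) + ONE light `D` with `L(E^{(D)},1) ≠ 0` (Friedberg–Hoffstein 1995 Thm. B / Waldspurger 1991)
  + Ono's proof verbatim at depth `ord₂ b(|D|)` (critic V#127-P2).
  The homogenisation «light base ⟹ all pair-products light over one residue class mod `24N_E` of
  `S_E`, of positive upper density» is PROVED here (`exists_homogeneous_subclass`: pigeonhole +
  Mathlib `Nat.tendsto_primeCounting`; `inLightClass_pair`: Jacobi multiplicativity).
* `stub_pairClassNumberCoprimeFrob` — BEYOND PRINT, LOAD-BEARING, E-free and L-free (the transferred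
  residual; REV 3, critic V#127-P1: stated for FROBENIAN `S` — a Chebotarev set, `IsFrobenian`, typed over
  the tree's `Chebotarev.primesOfFrobIn` — and an explicit residue subclass of positive upper density,
  the form the proved pigeonhole delivers; the adversarial all-`S` form survives only as the remark
  `Stmt.pairClassNumberCoprime` with `pairClassNumberCoprimeFrob_of_strong`).
* `stub_supplyEvenTorsionX10b` — DECLARED RESIDUAL: C⁺ itself on the complementary sub-class (a rational
  2-torsion point; census: 2 of the 39 N2-cell rank-one X10b pairs, `204490bl1`, `349690bk1`).
* `supplyOddTorsion_of_stubs : S1 → S2 → S3 → SupplyCoprimeFrameX10bOddTorsion` — SORRY-FREE.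
* `supplyCoprimeFrameX10b_of_odd_of_even`, `wallCornerX10b_of_stubs` — SORRY-FREE compositions to C⁺ and
  to the rung `Summit.BirchSwinnertonDyer.WAllCornerX10b` BY NAME (binders = route items 25233, 20682,
  21206, 20684 + the cite-only Yan–Zhu/BCS/CGLS composite, exactly as g8's line).

References: Ono 2001 (doi:10.1515/crll.2001.044) Thm. 1, Cor. 3, §2 Thm. 2.1 [survey: Ono–Papanikolas,
«Quadratic twists of modular forms and elliptic curves», Number Theory for the Millennium III, Thm. 1.1,
Cor. 1.2, Thm. 2.1]; Kriz–Li 2019 (doi:10.1017/fms.2019.9) Thm. 1.12, Def. 4.1, Thm. 4.3; Belabas–Fouvry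
1999 (doi:10.1215/S0012-7094-99-09807-1) Cor. 1.9; Beckwith 2017 (arXiv:1612.04443) §1 (Wiles 2015,
Horie–Nakagawa, Kohnen–Ono: cofactor uncontrolled); Bhargava–Varma 2016 Cor. 4 (a); route file
`Theses/PrintX10b.lean` rev 45; `Theorems/PrintX10bHowardAssembly.lean`, `Theorems/PrintX10bHowardRoad.lean` §3–§4.
-/

set_option autoImplicit false
set_option linter.dupNamespace false

noncomputable section

open scoped Classical

open WeierstrassCurve NumberField
  Literature.NumberTheory.EllipticCurves
  Summit.BirchSwinnertonDyer.BirchSwinnertonDyer.Theses.PrintX10b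

open Literature.NumberTheory.EllipticCurves.Rank1Residual (Surj ClassX10)

namespace Summit.BirchSwinnertonDyer.BirchSwinnertonDyer.Cruxes.HowardContainmentAnyClassNumberX10b.OnoWaldspurgerSupplyX10b

/-! ## The transferred crux C⁺ (verbatim from line «coprime-frame-supply», = `hFS3` of the tree kernel) -/

/-- **C⁺ — coprime light Heegner frame supply on X10b** (verbatim `CoprimeFrameSupplyX10b.SupplyCoprimeFrameX10b`). -/
def SupplyCoprimeFrameX10b : Prop :=
  ∀ (W : WeierstrassCurve ℚ) [W.IsElliptic] [W.IsGloballyMinimal] [NeZero (W.conductorNorm ℤ)]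
    (p : ℕ) [Fact p.Prime], ClassX10 W p → ¬ Surj W 3 → ¬ W.HasCM → W.analyticRank = 1 →
    ∃ (K : Type) (_ : Field K) (_ : NumberField K), IsImaginaryQuadratic K ∧
      Odd (NumberField.discr K) ∧ NumberField.discr K < -4 ∧
      SatisfiesHeegnerHypothesis (W.conductorNorm ℤ) K ∧ SatisfiesHeegnerHypothesis p K ∧
      ¬ p ∣ NumberField.classNumber K ∧
      (W.quadraticTwist (NumberField.discr K : ℚ)).entireLFunction 1 ≠ 0

/-- **C⁺ on the ODD-TORSION sub-class** (`2 ∤ #E(ℚ)_tors`, i.e. no rational point of order 2 — the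
hypothesis of Ono 2001 Cor. 3; census: 37 of the 39 N2-cell rank-one X10b pairs). -/
def SupplyCoprimeFrameX10bOddTorsion : Prop :=
  ∀ (W : WeierstrassCurve ℚ) [W.IsElliptic] [W.IsGloballyMinimal] [NeZero (W.conductorNorm ℤ)]
    (p : ℕ) [Fact p.Prime], ClassX10 W p → ¬ Surj W 3 → ¬ W.HasCM → Odd W.torsionOrder →
    W.analyticRank = 1 →
    ∃ (K : Type) (_ : Field K) (_ : NumberField K), IsImaginaryQuadratic K ∧
      Odd (NumberField.discr K) ∧ NumberField.discr K < -4 ∧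
      SatisfiesHeegnerHypothesis (W.conductorNorm ℤ) K ∧ SatisfiesHeegnerHypothesis p K ∧
      ¬ p ∣ NumberField.classNumber K ∧
      (W.quadraticTwist (NumberField.discr K : ℚ)).entireLFunction 1 ≠ 0

/-! ## Dictionary: light class, class-number coprimality, prime density, Ono data -/

/-- `d` is an odd negative fundamental discriminant `< -4` in which every prime `q ∣ M` splits
(verbatim `CoprimeFrameSupplyX10b.InLightClass`). -/
def InLightClass (M : ℕ) (d : ℤ) : Prop :=
  d < 0 ∧ d % 4 = 1 ∧ Squarefree d ∧ 4 < d.natAbs ∧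
    ∀ q : ℕ, q.Prime → q ∣ M → (q = 2 → d % 8 = 1) ∧ (q ≠ 2 → jacobiSym d q = 1)

/-- `p ∤ h(ℚ(√d))`, stated over every model of the field (verbatim `CoprimeFrameSupplyX10b.ClassNumberCoprime`). -/
def ClassNumberCoprime (p : ℕ) (d : ℤ) : Prop :=
  ∀ (K : Type) [Field K] [NumberField K], IsImaginaryQuadratic K → NumberField.discr K = d →
    ¬ p ∣ NumberField.classNumber K

/-- number of primes `p ≤ X` lying in `S`. -/
def primesInUpTo (S : Set ℕ) (X : ℕ) : ℕ :=
  ((Finset.range (X + 1)).filter (fun p ↦ p.Prime ∧ p ∈ S)).card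

/-- `S` has POSITIVE LOWER NATURAL DENSITY among the primes: `#{p ≤ X prime, p ∈ S} ≥ α·π(X)` for
some `α > 0` and ALL large `X` (`π` = Mathlib's `Nat.primeCounting`; forces `S` infinite). -/
def PrimesLowerDensityPos (S : Set ℕ) : Prop :=
  ∃ α : ℝ, 0 < α ∧ ∃ X₀ : ℕ, ∀ X : ℕ, X₀ ≤ X →
    α * (Nat.primeCounting X : ℝ) ≤ (primesInUpTo S X : ℝ)

/-- `S` has POSITIVE UPPER NATURAL DENSITY among the primes: `#{p ≤ X prime, p ∈ S} ≥ α·π(X)` for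
some `α > 0` and INFINITELY MANY `X` (what pigeonhole preserves when a lower-density set is cut into
residue classes — see `exists_homogeneous_subclass`). -/
def PrimesUpperDensityPos (S : Set ℕ) : Prop :=
  ∃ α : ℝ, 0 < α ∧ ∀ X₀ : ℕ, ∃ X : ℕ, X₀ ≤ X ∧
    α * (Nat.primeCounting X : ℝ) ≤ (primesInUpTo S X : ℝ)

/-- `S ⊆ ℕ` is FROBENIAN (Serre, *Lectures on N_X(p)* §3.3.1: "there exists a finite Galois extension
`E/ℚ` … and a subset `C` of its Galois group, stable under conjugation, such that `p ∈ S ⟺ σ_p ∈ C`",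
up to a finite set of primes): typed over the tree's `Chebotarev.primesOfFrobIn ℚ L C` (primes of `𝓞 ℚ`
unramified in `L` with all Frobenii in `C`) transported to rational primes by `LFunctions.natPrimesOf`.
Ono's `S_E` is of this shape: `Frob_p ∼ Frob_{p₀}` in the field cut out by the mod-`v^{j+1}` Deligne–Serre
representations of `F` and `G_F` (survey (2.8)). [cite: SerreNXp, §3.3.1] [cite: Ono2001Crelle533, (2.8)] -/
def IsFrobenian (S : Set ℕ) : Prop :=
  ∃ (L : Type) (_ : Field L) (_ : NumberField L) (_ : Algebra ℚ L) (_ : IsGalois ℚ L)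
    (C : Set (L ≃ₐ[ℚ] L)), (∀ g h : L ≃ₐ[ℚ] L, h ∈ C → g * h * g⁻¹ ∈ C) ∧
    ∃ B : Finset ℕ, ∀ p : ℕ, p.Prime → p ∉ B →
      (p ∈ S ↔ p ∈ Literature.NumberTheory.LFunctions.natPrimesOf
        (Literature.NumberTheory.LFunctions.Chebotarev.primesOfFrobIn ℚ L C))

/-- the part of `S` outside the finite set `B` in the residue class `c (mod m)` — the shape the proved
pigeonhole (`exists_homogeneous_subclass`) hands to S3; a frobenian `S` has frobenian subclasses
(compositum with `ℚ(ζ_m)`; not needed formally). -/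
abbrev Subclass (S : Set ℕ) (B : Finset ℕ) (m c : ℕ) : Set ℕ := {p | p ∈ S ∧ p ∉ B ∧ p % m = c}

/-- **An Ono datum for `W`**: a negative base `D` and a set `S` of primes not dividing `2D`, of
positive lower density, such that EVERY twist of `W` by `D` times a non-empty EVEN product of distinct
members of `S` has non-vanishing central value (the output shape of Ono 2001 Thm. 1 / §2 Thm. 2.1 at
`F = f_E`, `v ∣ 2`, root number `δ = -1`, so `δ·D_F > 0` means `D_F < 0`). [cite: Ono2001Crelle533, Thm. 1, Cor. 3] -/
def OnoFamily (W : WeierstrassCurve ℚ) (D : ℤ) (S : Set ℕ) : Prop :=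
  D < 0 ∧ (∀ p ∈ S, p.Prime ∧ ¬ (p : ℤ) ∣ 2 * D) ∧ IsFrobenian S ∧ PrimesLowerDensityPos S ∧
    ∀ T : Finset ℕ, (↑T : Set ℕ) ⊆ S → T.Nonempty → Even T.card →
      (W.quadraticTwist ((D * ∏ p ∈ T, (p : ℤ) : ℤ) : ℚ)).entireLFunction 1 ≠ 0

/-! ## The four stub statements -/

/-- **S1 (PRINT BY NAME — Ono 2001 Thm. 1 + Cor. 3; Chebotarev density).** An elliptic `W/ℚ` with
ODD torsion order (no rational point of order 2, equivalently `a_p(W)` odd for some good odd `p`: the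
mod-2 image contains a 3-cycle) and analytic rank `1` (root number `−1`) has an Ono datum.
Output-shape typing: the tree has no half-integral weight Hecke theory; a typer cites Ono's Theorem 1
(with `F = f_W`, modularity) and Chebotarev (REV 3: the output records that `S_F` is FROBENIAN — survey
(2.8): `Frob_p ∼ Frob_{p₀}` in a finite Galois extension — and has positive natural lower density, Serre
1981 §2.1 Thm. 1 = tree fact `Chebotarev.chebotarev_naturalDensity`; drop the finitely many primes
dividing `2D_F`). [cite: Ono2001Crelle533, Thm. 1, Cor. 3, Thm. 2.1, (2.8)] [cite: Serre1981, §2.1]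
[cite: OnoPapanikolasMillenniumIII, Thm. 1.1, Cor. 1.2, Thm. 2.1] -/
def Stmt.onoEvenProductFamily : Prop :=
  ∀ (W : WeierstrassCurve ℚ) [W.IsElliptic], Odd W.torsionOrder → W.analyticRank = 1 →
    ∃ (D : ℤ) (S : Set ℕ), OnoFamily W D S

/-- **S2 (PRINT-COMPOSITE since REV 3 — per-curve certificate = the cheap route; class-wide by the citation
chain below) — Ono's base discriminant can be taken LIGHT.** If a rank-one non-CM X10b curve with odd
torsion has an Ono datum at all, it has one whose base `D` lies in the light Heegner class of level
`3N_E` (`D < 0` odd squarefree, `D ≡ 1 (4)` — `≡ 1 (8)` if `2 ∣ N_E` —, every odd `q ∣ 3N_E` split in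
`ℚ(√D)`). CHAIN (critic V#127-P2; Ono's printed proof runs from ANY `m` with `b_F(m) ≠ 0`, at depth
`s := ord_v b_F(m)`, applying (2.8) with `j = s`: the `q^{mq₁}` coefficient of `G_F|T_{q₁}` has order
exactly `s` by (2.9), and (2.10) at depth `> s` gives `ord_v b(m q₁ q₂) = s`, hence `≠ 0`, hence
`L ≠ 0` by Waldspurger (2.3)): (i) a weight-3/2 form in the Waldspurger packet of `f_E` whose coefficients
SEE the light square class — exists iff the twists in that class have root number `+1` (Waldspurger 1981
Thm. 1; Baruch–Mao 2007), and for light `D < 0` coprime to `N_E` with every `q ∣ N_E` split,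
`w(E^{(D)}) = χ_D(−N_E)·w(E) = (−1)(+1)(−1) = +1` ✓; (ii) ONE light fundamental `D < 0` with
`L(E^{(D)},1) ≠ 0` — non-vanishing of quadratic twists with finitely many prescribed local square
classes compatible with root number `+1` (Friedberg–Hoffstein 1995 Thm. B; Waldspurger 1991;
Bump–Friedberg–Hoffstein 1990 / Murty–Murty 1991 for the method); (iii) Ono's argument verbatim at depth
`ord₂ b(|D|)`. The only residual failure mode «`b ≡ 0` on the whole light class» is excluded by (ii).
The passage light base ⟹ light PAIR-PRODUCTS over one residue class mod `24N_E` of `S` is PROVED below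
(`exists_homogeneous_subclass`, `inLightClass_pair`). Typing-heavy at non-squarefree `N_E` (X10b's
rank-one branch is `¬Semistable`), hence kept as ONE stub with the chain in words.
[cite: Ono2001Crelle533, proof of Thm. 2.1, (2.8)–(2.10)] [cite: Waldspurger1981, Thm. 1]
[cite: BaruchMao2007] [cite: FriedbergHoffstein1995, Thm. B] [cite: Beckwith2017, §1] -/
def Stmt.onoLightBase : Prop :=
  ∀ (W : WeierstrassCurve ℚ) [W.IsElliptic] [W.IsGloballyMinimal] [NeZero (W.conductorNorm ℤ)]
    (p : ℕ) [Fact p.Prime], ClassX10 W p → ¬ Surj W 3 → ¬ W.HasCM → Odd W.torsionOrder →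
    W.analyticRank = 1 → (∃ (D : ℤ) (S : Set ℕ), OnoFamily W D S) →
    ∃ (D : ℤ) (S : Set ℕ), OnoFamily W D S ∧ InLightClass (W.conductorNorm ℤ * 3) D

/-- **S3-strong (REMARK, not a stub since REV 3).** The REV 2 form of S3: for EVERY set `S` of primes of
positive upper density all of whose pair-products are light, some pair-product has `3 ∤ h`. As critic
V#127-P1 observes this is a clique-freeness statement for the 3-irregularity graph over ADVERSARIAL
vertex sets — true in the random model, reachable by no sieve (it would need bilinear equidistribution of
`r₃` over `S × S`). It trivially implies the registered S3 (`pairClassNumberCoprimeFrob_of_strong`);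
kept only as the honest upper envelope. [cite: BelabasFouvry1999, Cor. 1.9] -/
def Stmt.pairClassNumberCoprime : Prop :=
  ∀ (M : ℕ), 0 < M → ∀ (D : ℤ) (S : Set ℕ), (∀ p ∈ S, p.Prime) → PrimesUpperDensityPos S →
    (∀ p₁ ∈ S, ∀ p₂ ∈ S, p₁ ≠ p₂ → InLightClass M (D * p₁ * p₂)) →
    ∃ p₁ ∈ S, ∃ p₂ ∈ S, p₁ ≠ p₂ ∧ ClassNumberCoprime 3 (D * p₁ * p₂)

/-- **S3 (BEYOND PRINT, LOAD-BEARING; E-free, L-free; FROBENIAN form, REV 3) — light pair-products over a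
Chebotarev set with class number prime to 3.** For every level `M > 0`, base `D`, FROBENIAN set `S` of
primes of positive lower density (a Chebotarev class, up to finitely many primes — exactly what Ono's
(2.8) hands over), finite `B` and residue class `c (mod m)` such that the subclass
`S' = {p ∈ S : p ∉ B, p ≡ c (m)}` has positive upper density and ALL pair-products `D·p₁·p₂`,
`p₁ ≠ p₂ ∈ S'`, are light of level `M`: SOME such pair-product has `3 ∤ h(D p₁ p₂)`. (`S'` is again
frobenian — compositum with `ℚ(ζ_m)` — so in print this is «S3-strong restricted to frobenian sets»;
the subclass data is explicit only because the proved pigeonhole produces it and closure of frobenian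
sets under residue-class intersection is not formalised.) Heuristic: `3 ∣ h` has density ≈ 0.44 on
imaginary quadratic discriminants with local conditions (Davenport–Heilbronn; Bhargava–Shankar–Tsimerman
Thm. 8 for acceptable local specifications; mean `#Cl[3] = 2`), and an all-`3 ∣ h` clique of positive
density among ≍ X²/log²X pair-products contradicts the random model (cliques `O(log X)`). What a proof
needs: a Davenport–Heilbronn∘sieve count of `3 ∤ h(D p₁ p₂)` with BOTH prime factors constrained to a
(possibly non-abelian) Chebotarev class — for abelian classes a congruence condition à la Belabas–Fouvry
1999 Cor. 1.9 (II) / Fouvry 1999 (pairs `p₁ ≡ p₂ ≡ 1 (4)`), for non-abelian classes a Chebotarev–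
Bombieri–Vinogradov input (Murty–Murty type) for the larger factor: the genuinely new analytic input,
NOT IN PRINT (presearch REV 3: corpus fts+vec + galaxy, nearest BF99 p.8, Fouvry BSMF 127 p.96/p.112,
BST arXiv:1005.0672 Thms. 6/8). [cite: BelabasFouvry1999, Cor. 1.9] [cite: Fouvry1999BSMF, Thm. p. 96]
[cite: BhargavaShankarTsimerman2013, Thm. 8] [cite: SerreNXp, §3.3.1] -/
def Stmt.pairClassNumberCoprimeFrob : Prop :=
  ∀ (M : ℕ), 0 < M → ∀ (D : ℤ) (S : Set ℕ), (∀ p ∈ S, p.Prime) → IsFrobenian S →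
    PrimesLowerDensityPos S → ∀ (B : Finset ℕ) (m c : ℕ), PrimesUpperDensityPos (Subclass S B m c) →
    (∀ p₁ ∈ Subclass S B m c, ∀ p₂ ∈ Subclass S B m c, p₁ ≠ p₂ → InLightClass M (D * p₁ * p₂)) →
    ∃ p₁ ∈ Subclass S B m c, ∃ p₂ ∈ Subclass S B m c, p₁ ≠ p₂ ∧ ClassNumberCoprime 3 (D * p₁ * p₂)

/-- S3-strong ⟹ S3 (nothing is lost by the frobenian retyping). -/
theorem pairClassNumberCoprimeFrob_of_strong (h : Stmt.pairClassNumberCoprime) :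
    Stmt.pairClassNumberCoprimeFrob := by
  intro M hM D S hSpr _ _ B m c hup hlight
  exact h M hM D (Subclass S B m c) (fun q hq ↦ hSpr q hq.1) hup hlight

/-- **S4 (DECLARED RESIDUAL) — C⁺ on the complementary sub-class** (torsion order NOT odd: a rational
point of order 2, where Ono's hypothesis `∃ p, a_p odd` fails identically; census `204490bl1`,
`349690bk1`). This IS the crux on a sub-class — flagged, not hidden. -/
def Stmt.supplyEvenTorsionX10b : Prop :=
  ∀ (W : WeierstrassCurve ℚ) [W.IsElliptic] [W.IsGloballyMinimal] [NeZero (W.conductorNorm ℤ)]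
    (p : ℕ) [Fact p.Prime], ClassX10 W p → ¬ Surj W 3 → ¬ W.HasCM → ¬ Odd W.torsionOrder →
    W.analyticRank = 1 →
    ∃ (K : Type) (_ : Field K) (_ : NumberField K), IsImaginaryQuadratic K ∧
      Odd (NumberField.discr K) ∧ NumberField.discr K < -4 ∧
      SatisfiesHeegnerHypothesis (W.conductorNorm ℤ) K ∧ SatisfiesHeegnerHypothesis p K ∧
      ¬ p ∣ NumberField.classNumber K ∧
      (W.quadraticTwist (NumberField.discr K : ℚ)).entireLFunction 1 ≠ 0

/-! ## Registered stubs -/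

/-- S1 — PRINT BY NAME. [cite: Ono2001Crelle533, Thm. 1, Cor. 3] -/
theorem stub_onoEvenProductFamily : Stmt.onoEvenProductFamily := by
  sorry

/-- S2 — BEYOND PRINT (per curve, mild). -/
theorem stub_onoLightBase : Stmt.onoLightBase := by
  sorry

/-- S3 — BEYOND PRINT, LOAD-BEARING (E-free, L-free). -/
theorem stub_pairClassNumberCoprimeFrob : Stmt.pairClassNumberCoprimeFrob := by
  sorry

/-- S4 — DECLARED RESIDUAL (C⁺ on the even-torsion sub-class). -/
theorem stub_supplyEvenTorsionX10b : Stmt.supplyEvenTorsionX10b := by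
  sorry

/-! ## Proved: homogenisation of an Ono datum (Lemma A: pigeonhole; Lemma B: pair-lightness) -/

/-- **Lemma A (PROVED).** A set of primes of positive lower density, with a finite set `B` removed,
has a residue class mod `m` of positive UPPER density (pigeonhole at every large scale + finiteness of
the set of classes; Mathlib `Nat.tendsto_primeCounting` absorbs `#B`). -/
theorem exists_homogeneous_subclass {S : Set ℕ} (hS : PrimesLowerDensityPos S) (B : Finset ℕ)
    {m : ℕ} (hm : 0 < m) :
    ∃ c < m, PrimesUpperDensityPos {p | p ∈ S ∧ p ∉ B ∧ p % m = c} := by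
  obtain ⟨α, hα, X₀, hX₀⟩ := hS
  set α' : ℝ := α / (2 * m) with hα'
  have hmR : (0 : ℝ) < m := by exact_mod_cast hm
  have hα'pos : 0 < α' := by positivity
  by_contra hcon
  push Not at hcon
  -- for every class `c < m`, eventually the class count is `< α' π(X)`
  have hcls : ∀ c : ℕ, ∃ Xc : ℕ, ∀ X : ℕ, Xc ≤ X → c < m →
      (primesInUpTo {p | p ∈ S ∧ p ∉ B ∧ p % m = c} X : ℝ) < α' * Nat.primeCounting X := by
    intro c
    by_cases hc : c < m
    · have h := hcon c hc
      simp only [PrimesUpperDensityPos, not_exists, not_and, not_forall, not_le] at h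
      obtain ⟨Xc, hXc⟩ := h α' hα'pos
      exact ⟨Xc, fun X hX _ ↦ hXc X hX⟩
    · exact ⟨0, fun X _ hc' ↦ absurd hc' hc⟩
  choose Xc hXc using hcls
  -- `π(X) → ∞`: eventually `#B ≤ (α/2) π(X)`
  obtain ⟨X₁, hX₁⟩ : ∃ X₁ : ℕ, ∀ X, X₁ ≤ X → (B.card : ℝ) ≤ α / 2 * Nat.primeCounting X := by
    obtain ⟨N, hN⟩ := Filter.eventually_atTop.1
      (Nat.tendsto_primeCounting.eventually_ge_atTop (⌈(B.card : ℝ) / (α / 2)⌉₊))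
    refine ⟨N, fun X hX ↦ ?_⟩
    have h1 : ((⌈(B.card : ℝ) / (α / 2)⌉₊ : ℕ) : ℝ) ≤ Nat.primeCounting X := by exact_mod_cast hN X hX
    have h2 : (B.card : ℝ) / (α / 2) ≤ Nat.primeCounting X := (Nat.le_ceil _).trans h1
    have hα2 : 0 < α / 2 := by positivity
    rwa [div_le_iff₀ hα2, mul_comm] at h2
  -- the scale where everything holds
  set X : ℕ := max (max X₀ X₁) ((Finset.range m).sup Xc) with hXdef
  have hXX₀ : X₀ ≤ X := (le_max_left _ _).trans (le_max_left _ _)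
  have hXX₁ : X₁ ≤ X := (le_max_right _ _).trans (le_max_left _ _)
  have hXc' : ∀ c ∈ Finset.range m, Xc c ≤ X := fun c hc ↦
    (Finset.le_sup hc).trans (le_max_right _ _)
  -- the sets at scale X
  set F : Finset ℕ := (Finset.range (X + 1)).filter (fun p ↦ p.Prime ∧ p ∈ S ∧ p ∉ B) with hF
  have hFS : (primesInUpTo S X : ℝ) ≤ F.card + B.card := by
    have hsub : (Finset.range (X + 1)).filter (fun p ↦ p.Prime ∧ p ∈ S) ⊆ F ∪ B := by
      intro p hp
      simp only [Finset.mem_filter, Finset.mem_range] at hp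
      by_cases hpB : p ∈ B
      · exact Finset.mem_union_right _ hpB
      · exact Finset.mem_union_left _ (by
          simp only [hF, Finset.mem_filter, Finset.mem_range]; exact ⟨hp.1, hp.2.1, hp.2.2, hpB⟩)
    have := (Finset.card_le_card hsub).trans (Finset.card_union_le _ _)
    exact_mod_cast this
  -- fiberwise decomposition of F by residue mod m
  have hfib : F.card = ∑ c ∈ Finset.range m, (F.filter (fun p ↦ p % m = c)).card :=
    Finset.card_eq_sum_card_fiberwise (f := fun p : ℕ ↦ p % m)
      (fun p _ ↦ Finset.mem_range.2 (Nat.mod_lt p hm))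
  have hFc : ∀ c ∈ Finset.range m,
      ((F.filter (fun p ↦ p % m = c)).card : ℝ) =
        primesInUpTo {p | p ∈ S ∧ p ∉ B ∧ p % m = c} X := by
    intro c _
    simp only [primesInUpTo, hF, Finset.filter_filter]
    congr 2
    ext p
    simp only [Set.mem_setOf_eq, and_assoc]
  -- sum of class counts is `< m · α' π(X) = (α/2) π(X)`
  have hlt : (F.card : ℝ) < α / 2 * Nat.primeCounting X := by
    have hsum : (F.card : ℝ) = ∑ c ∈ Finset.range m, ((F.filter (fun p ↦ p % m = c)).card : ℝ) := by
      exact_mod_cast hfib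
    rw [hsum]
    calc ∑ c ∈ Finset.range m, ((F.filter (fun p ↦ p % m = c)).card : ℝ)
        < ∑ _c ∈ Finset.range m, α' * Nat.primeCounting X := by
          apply Finset.sum_lt_sum_of_nonempty (Finset.nonempty_range_iff.2 hm.ne')
          intro c hc
          rw [hFc c hc]
          exact hXc c X (hXc' c hc) (Finset.mem_range.1 hc)
      _ = α / 2 * Nat.primeCounting X := by
          have hm0 : (m : ℝ) ≠ 0 := hmR.ne'
          rw [Finset.sum_const, Finset.card_range, nsmul_eq_mul, hα']
          field_simp
  -- but `(α/2)π ≤ απ - #B ≤ #F`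
  have hge : α / 2 * Nat.primeCounting X ≤ F.card := by
    have h0 := hX₀ X hXX₀
    have h1 := hX₁ X hXX₁
    linarith
  exact absurd hlt (not_lt.2 hge)


/-- **Lemma B (PROVED).** Pair-products `D·p₁·p₂` of a LIGHT base `D` with two distinct primes
`p₁ ≡ p₂ (mod 8M)` not dividing `2DM` are light of level `M`: `D p₁ p₂ ≡ D p₁² ≡ D (mod 8)` and
`(D p₁ p₂ / q) = (D/q)·(p₁/q)² = 1` for odd `q ∣ M` (`jacobiSym.mul_left`, `jacobiSym.mod_left`,
`jacobiSym.sq_one`), squarefree by coprimality. -/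
theorem inLightClass_pair {M : ℕ} {D : ℤ} (hD : InLightClass M D) {p₁ p₂ : ℕ}
    (hp₁ : p₁.Prime) (hp₂ : p₂.Prime) (hne : p₁ ≠ p₂)
    (h₁ : ¬ (p₁ : ℤ) ∣ 2 * D) (h₂ : ¬ (p₂ : ℤ) ∣ 2 * D) (hM₁ : ¬ p₁ ∣ M) (hM₂ : ¬ p₂ ∣ M)
    (hmod : p₁ % (8 * M) = p₂ % (8 * M)) : InLightClass M (D * p₁ * p₂) := by
  obtain ⟨hDneg, hD4, hDsq, hD4lt, hDloc⟩ := hD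
  -- the primes are odd and prime to D
  have hp₁2 : p₁ ≠ 2 := by rintro rfl; exact h₁ (dvd_mul_right _ _)
  have hp₂2 : p₂ ≠ 2 := by rintro rfl; exact h₂ (dvd_mul_right _ _)
  have hD₁ : ¬ p₁ ∣ D.natAbs := fun h ↦ h₁ (dvd_mul_of_dvd_right (Int.natCast_dvd.2 h) _)
  have hD₂ : ¬ p₂ ∣ D.natAbs := fun h ↦ h₂ (dvd_mul_of_dvd_right (Int.natCast_dvd.2 h) _)
  have h3₁ : 3 ≤ p₁ := by have := hp₁.two_le; omega
  have h3₂ : 3 ≤ p₂ := by have := hp₂.two_le; omega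
  -- mod 8
  have hmod8 : p₁ % 8 = p₂ % 8 := by
    have a := Nat.mod_mod_of_dvd p₁ (dvd_mul_right 8 M)
    have b := Nat.mod_mod_of_dvd p₂ (dvd_mul_right 8 M)
    rw [← a, ← b, hmod]
  have hodd₂ : p₂ % 2 = 1 := by
    rcases Nat.mod_two_eq_zero_or_one p₂ with h0 | h1
    · rcases hp₂.eq_one_or_self_of_dvd 2 (Nat.dvd_of_mod_eq_zero h0) with h | h <;> omega
    · exact h1
  have hy : (p₂ : ZMod 8) * (p₂ : ZMod 8) = 1 := by
    rw [← ZMod.natCast_mod p₂ 8]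
    have key : p₂ % 8 = 1 ∨ p₂ % 8 = 3 ∨ p₂ % 8 = 5 ∨ p₂ % 8 = 7 := by omega
    rcases key with h | h | h | h <;> rw [h] <;> decide
  have hx : (p₁ : ZMod 8) = (p₂ : ZMod 8) := (ZMod.natCast_eq_natCast_iff' p₁ p₂ 8).2 hmod8
  have hd8 : (D * p₁ * p₂) % 8 = D % 8 := by
    have h : ((D * p₁ * p₂ : ℤ) : ZMod 8) = ((D : ℤ) : ZMod 8) := by
      push_cast
      rw [hx, mul_assoc, hy, mul_one]
    have h' := (ZMod.intCast_eq_intCast_iff' _ _ 8).1 h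
    exact_mod_cast h'
  refine ⟨?_, ?_, ?_, ?_, ?_⟩
  · -- negative
    have : (0 : ℤ) < (p₁ : ℤ) * p₂ := by positivity
    nlinarith
  · -- ≡ 1 mod 4
    generalize hd : D * (p₁ : ℤ) * (p₂ : ℤ) = d at hd8 ⊢
    omega
  · -- squarefree
    rw [← Int.squarefree_natAbs]
    have habs : (D * p₁ * p₂).natAbs = D.natAbs * p₁ * p₂ := by
      simp [Int.natAbs_mul]
    rw [habs, Nat.squarefree_mul_iff, Nat.squarefree_mul_iff]
    refine ⟨?_, ⟨?_, Int.squarefree_natAbs.2 hDsq, hp₁.prime.squarefree⟩, hp₂.prime.squarefree⟩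
    · exact Nat.Coprime.mul_left ((Nat.Prime.coprime_iff_not_dvd hp₂).2 hD₂).symm
        ((Nat.coprime_primes hp₁ hp₂).2 hne)
    · exact ((Nat.Prime.coprime_iff_not_dvd hp₁).2 hD₁).symm
  · -- |d| > 4
    have habs : (D * p₁ * p₂).natAbs = D.natAbs * p₁ * p₂ := by
      simp [Int.natAbs_mul]
    rw [habs]
    have hDa : 1 ≤ D.natAbs := by omega
    calc 4 < 1 * 3 * 3 := by norm_num
      _ ≤ D.natAbs * p₁ * p₂ := by gcongr
  · -- local conditions at q ∣ M
    intro q hq hqM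
    refine ⟨fun hq2 ↦ ?_, fun hq2 ↦ ?_⟩
    · subst hq2
      rw [hd8]; exact (hDloc 2 hq hqM).1 rfl
    · have hDq : jacobiSym D q = 1 := (hDloc q hq hqM).2 hq2
      have hq₂ : p₂ ≠ q := fun h ↦ hM₂ (h ▸ hqM)
      have hmodq : (p₁ : ℤ) % q = (p₂ : ℤ) % q := by
        have hq8 : q ∣ 8 * M := dvd_mul_of_dvd_right hqM 8
        have a := Nat.mod_mod_of_dvd p₁ hq8
        have b := Nat.mod_mod_of_dvd p₂ hq8
        have : p₁ % q = p₂ % q := by rw [← a, ← b, hmod]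
        exact_mod_cast this
      have hJ : jacobiSym (p₁ : ℤ) q = jacobiSym (p₂ : ℤ) q := by
        rw [jacobiSym.mod_left (p₁ : ℤ) q, jacobiSym.mod_left (p₂ : ℤ) q, hmodq]
      have hsq : jacobiSym (p₂ : ℤ) q ^ 2 = 1 := by
        apply jacobiSym.sq_one
        rw [Int.gcd_natCast_natCast]
        exact (Nat.coprime_primes hp₂ hq).2 hq₂
      rw [jacobiSym.mul_left, jacobiSym.mul_left, hDq, hJ, one_mul, ← sq, hsq]

/-! ## Compositions (sorry-free) -/

/-- **S1 ∧ S2 ∧ S3 ⟹ C⁺ on the odd-torsion sub-class.** -/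
theorem supplyOddTorsion_of_stubs (h1 : Stmt.onoEvenProductFamily) (h2 : Stmt.onoLightBase)
    (h3 : Stmt.pairClassNumberCoprimeFrob) : SupplyCoprimeFrameX10bOddTorsion := by
  intro W _ _ _ p _ hX hns hcm hodd hr
  obtain ⟨hp3, -, -, -⟩ := id hX
  subst hp3
  set M : ℕ := W.conductorNorm ℤ * 3 with hM
  have hMpos : 0 < M := Nat.mul_pos (Nat.pos_of_ne_zero (NeZero.ne _)) (by norm_num)
  -- an Ono datum with LIGHT BASE (S1 print + S2): frobenian `S` of positive lower density
  obtain ⟨D, S, ⟨hDneg, hSpr, hfrob, hdens, heven⟩, hDl⟩ := h2 W 3 hX hns hcm hodd hr (h1 W hodd hr)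
  -- homogenise (PROVED, Lemma A): one residue class mod `8M`, the divisors of `M` removed
  obtain ⟨c, -, hup⟩ := exists_homogeneous_subclass hdens M.divisors (m := 8 * M) (by omega)
  have hS'S : Subclass S M.divisors (8 * M) c ⊆ S := fun q hq ↦ hq.1
  have hS'pr : ∀ q ∈ Subclass S M.divisors (8 * M) c, q.Prime := fun q hq ↦ (hSpr q hq.1).1
  have hS'M : ∀ q ∈ Subclass S M.divisors (8 * M) c, ¬ q ∣ M :=
    fun q hq hdvd ↦ hq.2.1 (Nat.mem_divisors.2 ⟨hdvd, hMpos.ne'⟩)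
  -- all pair-products over the homogeneous class are light (PROVED, Lemma B)
  have hlight : ∀ p₁ ∈ Subclass S M.divisors (8 * M) c, ∀ p₂ ∈ Subclass S M.divisors (8 * M) c,
      p₁ ≠ p₂ → InLightClass M (D * p₁ * p₂) :=
    fun p₁ hp₁ p₂ hp₂ hne ↦ inLightClass_pair hDl (hS'pr p₁ hp₁) (hS'pr p₂ hp₂) hne
      (hSpr p₁ hp₁.1).2 (hSpr p₂ hp₂.1).2 (hS'M p₁ hp₁) (hS'M p₂ hp₂) (hp₁.2.2.trans hp₂.2.2.symm)
  -- S3 (frobenian form): a light pair-product over the subclass with class number prime to 3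
  obtain ⟨p₁, hp₁, p₂, hp₂, hne, hh⟩ :=
    h3 M hMpos D S (fun q hq ↦ (hSpr q hq).1) hfrob hdens M.divisors (8 * M) c hup hlight
  obtain ⟨hdneg, hd4, hsq, hBd, hspl⟩ := hlight p₁ hp₁ p₂ hp₂ hne
  -- its L-value: the even product `T = {p₁, p₂} ⊆ S` (Ono)
  have hTsub : (↑({p₁, p₂} : Finset ℕ) : Set ℕ) ⊆ S := by
    intro x hx
    simp only [Finset.coe_insert, Finset.coe_singleton, Set.mem_insert_iff,
      Set.mem_singleton_iff] at hx
    rcases hx with rfl | rfl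
    · exact hS'S hp₁
    · exact hS'S hp₂
  have hL : (W.quadraticTwist ((D * p₁ * p₂ : ℤ) : ℚ)).entireLFunction 1 ≠ 0 := by
    have h := heven {p₁, p₂} hTsub ⟨p₁, by simp⟩ (by rw [Finset.card_pair hne]; exact even_two)
    rwa [Finset.prod_pair hne, ← mul_assoc] at h
  -- from the discriminant to the field
  obtain ⟨K, _, _, hK, hBK, hH, hPK⟩ :=
    (exists_heegnerField_iff_exists_fundamental M 4
      (fun D ↦ D % 4 = 1 ∧ ClassNumberCoprime 3 D ∧
        (W.quadraticTwist (D : ℚ)).entireLFunction 1 ≠ 0)).mpr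
      ⟨D * p₁ * p₂, hdneg, Or.inl ⟨hd4, hsq, by omega⟩, hBd, hspl, hd4, hh, hL⟩
  obtain ⟨hK4, hhK, hLK⟩ := hPK
  have hneg : NumberField.discr K < 0 := IsImaginaryQuadratic.discr_neg hK
  refine ⟨K, inferInstance, inferInstance, hK, Int.odd_iff.mpr (by omega), by omega,
    hH.of_dvd (dvd_mul_right _ _), hH.of_dvd (dvd_mul_left _ _), hhK K hK rfl, hLK⟩

/-- **odd-torsion supply ∧ the residual S4 ⟹ C⁺.** -/
theorem supplyCoprimeFrameX10b_of_odd_of_even (hodd : SupplyCoprimeFrameX10bOddTorsion)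
    (heven : Stmt.supplyEvenTorsionX10b) : SupplyCoprimeFrameX10b := by
  intro W _ _ _ p _ hX hns hcm hr
  by_cases h : Odd W.torsionOrder
  · exact hodd W p hX hns hcm h hr
  · exact heven W p hX hns hcm h hr

/-- **C⁺ ⟹ the X10b leaf** (tree kernel `X10.howardAssemblyThree_of_howardFrameSupply`, binders =
route items + one cite-only composite; exactly as line «coprime-frame-supply»). -/
theorem bsdpOnClassX10b_of_supply (hS : SupplyCoprimeFrameX10b)
    (hMZ : MastellaZermanHowardDivisibility)
    (hYZ : YanZhu2026.thm57_thm59_bcs422_cgls513_generator_constantCoeff_of_heegnerDivisibility)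
    (hA : AnalyticMuZeroX10b) (hHP : HeegnerPrintFactsX10b) (hP : PrintFactsX10b) :
    Summit.BirchSwinnertonDyer.Rank1Residual.X10.BSDpOnClassX10b :=
  Summit.BirchSwinnertonDyer.Rank1Residual.X10.howardAssemblyThree_of_howardFrameSupply hS hMZ hYZ hA hHP hP

/-- **The registered composition: stubs ⟹ the rung `WAllCornerX10b` BY NAME** (sorries only inside
`stub_*`). -/
theorem wallCornerX10b_of_stubs
    (hMZ : MastellaZermanHowardDivisibility)
    (hYZ : YanZhu2026.thm57_thm59_bcs422_cgls513_generator_constantCoeff_of_heegnerDivisibility)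
    (hA : AnalyticMuZeroX10b) (hHP : HeegnerPrintFactsX10b) (hP : PrintFactsX10b) :
    Summit.BirchSwinnertonDyer.WAllCornerX10b :=
  Summit.BirchSwinnertonDyer.Rank1Residual.WAll.wallCornerX10b_of_bsdpOnClassX10b
    (bsdpOnClassX10b_of_supply
      (supplyCoprimeFrameX10b_of_odd_of_even
        (supplyOddTorsion_of_stubs stub_onoEvenProductFamily stub_onoLightBase
          stub_pairClassNumberCoprimeFrob)
        stub_supplyEvenTorsionX10b)
      hMZ hYZ hA hHP hP)

end Summit.BirchSwinnertonDyer.BirchSwinnertonDyer.Cruxes.HowardContainmentAnyClassNumberX10b.OnoWaldspurgerSupplyX10b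

end
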